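import Summits.ValiantsHypothesis.ValiantsHypothesis.Theorems.LacunarySymmetroidMatrixDescartesCensusDoorA34SheetIsotropicCone
import Summits.ValiantsHypothesis.ValiantsHypothesis.Theorems.LacunarySymmetroidMatrixDescartesCensusDoorA34SheetSemidefPairLaw
import Summits.ValiantsHypothesis.ValiantsHypothesis.Theorems.LacunarySymmetroidMatrixDescartesCensusLP34Kit

/-!
# `MatrixDescartes` census — DOOR A at `(3,4)`: HIDDEN DEFINITENESS on the semidefinite cell of the null-top sheet — the signs of three slots pin the
# inertia type of every lower letter, so the definite-letter tests run WITHOUT a definite letter being assumed (type tests DI / DD, all sorted supports)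

HONEST FRAMING.  Object-search cell `pub-symmetroid`, engine seat `val-sym-eng-2` (g5); helper rows beside the registered strata line
`Cruxes/DoorA34/Lines/strata.lean` on stmt-ValiantsHypothesis-19980 (`DoorA34 = PosRootLawAt 3 4 18`: OPEN, typed, never asserted here).  Third file of the
seat after …SheetIsotropicCone (the cone / pair law) and …SheetSemidefPairLaw (pair test).  The door-p3 / g4 definite-letter laws (…SheetDefiniteLetter:
`definite_pair_count_sheet`, `definite_indefinite_count_sheet`) ASSUME a definite lower letter.  In the semidefinite cell (`S₃ ⪰ 0`; `S₃ ⪯ 0` by `S ↦ −S`)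
that assumption is DISCHARGED BY SIGNS:

* `posSemidef_of_adjugate_witness` / **`posDef_of_adjugate_witness`** — a decomposition-free criterion for symmetric `3 × 3` matrices: `v ≠ 0` with
  `vᵀ adj(S) v > 0`, `k ⊥ v` with `kᵀSk > 0`, `det S > 0` ⇒ `S ≻ 0` (the plane `v^⊥` is `S`-nonnegative by the Lagrange–adjugate identity on `k × w ∥ v`;
  split any `x` along `z = adj(S)v`, which is `S`-conjugate to `v^⊥` with `zᵀSz = det S·vᵀadj(S)v`; then `det ≠ 0`);
* **`posDef_of_sheet_signs`** / `neg_posDef_of_sheet_signs` — `P ⪰ 0` singular (`Pk = 0`), `q(S) = tr(adj S·P) > 0`, `det S > 0`, `kᵀSk > 0` ⇒ `S ≻ 0`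
  (some row of `B`, `P = BᵀB`, is an adjugate witness); `not_definite_of_trace_adjugate_mul_neg`, `not_definite_of_dotProduct_mulVec_mul_det_neg`;
* **`hiddenType_of_nullTop_eighteen`** — on a null-top eighteen with `S₃ ⪰ 0`, for every lower letter `x`: `c_{3xx} > 0 ∧ c_{xxx} > 0 ∧ c_{33x} > 0 ⇒ S_x ≻ 0`,
  `c_{3xx} > 0 ∧ c_{xxx} < 0 ∧ c_{33x} < 0 ⇒ S_x ≺ 0`, `c_{3xx} < 0` or `c_{xxx}c_{33x} < 0 ⇒ S_x` not definite (`top_slot_mul_dotProduct_mulVec_pos_of_nullTop_eighteen`: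
  `c_{33x}` has the sign of `kᵀS_xk`) — the three slot signs PIN THE TYPE of each lower letter;
* **`card_posRoots_le_17_of_semidef_typeTestDI`** / **`…DD`** — decidable chamber tests (sheet rank `ρ`, orientation `(−1)^{ρ(2d_x+d₃)}det S₀ > 0`): a
  hidden-definite `x` against a hidden-indefinite `y` with `V_xy ∈ {0,3}`, or two hidden-definite letters with the wrong `V_xy`, force `Z₊ ≤ 17`.

LOCATED (seat atlas, report HOME/DOOR-A34-ENG2G5-REPORT.md): together with the pair test these tests kill `37 + 41` of the `2 × 80` oriented semidefinite chamber
classes of the null-top sheet, the search realises the fully alternating word on `42 + 33` of them (0 contradictions, ≤ 8 undecided), and on `80/80` chambers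
of the INDEFINITE cell — where no sign-level law exists at all.  Nothing here bounds anything else; `DoorA34` and the three stubs stay OPEN; registers unchanged;
nothing on `MatrixDescartes` (stmt-ValiantsHypothesis-18050) or `VP ≠ VNP` — VP≠VNP not moved.  [folklore] Lagrange identity, Schur-type splitting, Descartes
(sharp case) bookkeeping; elementary.
-/

-- `Summit.ValiantsHypothesis.ValiantsHypothesis.…` repeats a component by the D-0017 layout
-- (single-conjunct summit), which the `dupNamespace` linter flags; the name is mandated.
set_option linter.dupNamespace false

namespace Summit.ValiantsHypothesis.ValiantsHypothesis.Theorems.LacunarySymmetroidMatrixDescartes.Census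

open Polynomial Finset Matrix
open scoped BigOperators Polynomial Matrix

/-! ## 1. A decomposition-free positive-definiteness criterion for symmetric `3 × 3` matrices -/

/-- For symmetric `S`: `u ⬝ᵥ S *ᵥ y = y ⬝ᵥ S *ᵥ u`. [folklore] -/
theorem dotProduct_mulVec_comm_of_isSymm {S : Matrix (Fin 3) (Fin 3) ℝ} (hS : S.IsSymm) (u y : Fin 3 → ℝ) :
    u ⬝ᵥ S *ᵥ y = y ⬝ᵥ S *ᵥ u := by
  rw [Matrix.dotProduct_mulVec, ← Matrix.mulVec_transpose, hS.eq, dotProduct_comm]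

/-- A vector with `v × z = 0` is parallel to `v`: `(v·v)•z = (v·z)•v`. [folklore] -/
theorem smul_eq_smul_of_cross_eq_zero {v z : Fin 3 → ℝ} (h : v ⨯₃ z = 0) : (v ⬝ᵥ v) • z = (v ⬝ᵥ z) • v := by
  have e := cross_cross_eq_smul_sub_smul' v v z
  rw [h, map_zero] at e
  exact (sub_eq_zero.mp e.symm).symm

/-- Two vectors orthogonal to `v` have cross product parallel to `v`: `(v·v)•(k × w) = (v·(k × w))•v`. [folklore] -/
theorem smul_cross_eq_of_orthogonal {v k w : Fin 3 → ℝ} (hk : k ⬝ᵥ v = 0) (hw : w ⬝ᵥ v = 0) :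
    (v ⬝ᵥ v) • (k ⨯₃ w) = (v ⬝ᵥ (k ⨯₃ w)) • v := by
  refine smul_eq_smul_of_cross_eq_zero ?_
  rw [cross_cross_eq_smul_sub_smul', dotProduct_comm v w, hw, hk, zero_smul, zero_smul, sub_zero]

/-- The adjugate form scales quadratically. [folklore] -/
theorem dotProduct_mulVec_smul_self (A : Matrix (Fin 3) (Fin 3) ℝ) (c : ℝ) (y : Fin 3 → ℝ) :
    (c • y) ⬝ᵥ A *ᵥ (c • y) = c ^ 2 * (y ⬝ᵥ A *ᵥ y) := by
  rw [Matrix.mulVec_smul, dotProduct_smul, smul_dotProduct, smul_eq_mul, smul_eq_mul]; ring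

/-- The real dot square of a nonzero vector is positive (local copy, `Fin 3`). [folklore] -/
private theorem dotProduct_self_pos_aux {v : Fin 3 → ℝ} (hv : v ≠ 0) : 0 < v ⬝ᵥ v :=
  lt_of_le_of_ne (by
      simp only [dotProduct, Fin.sum_univ_three]
      nlinarith [mul_self_nonneg (v 0), mul_self_nonneg (v 1), mul_self_nonneg (v 2)])
    (Ne.symm fun h => hv (dotProduct_self_eq_zero.mp h))

/-- **Plane semidefiniteness from an adjugate witness.**  `S` symmetric, `v ≠ 0` with `vᵀ adj(S) v ≥ 0`, `k ⊥ v` with `kᵀSk > 0`: then `wᵀSw ≥ 0` for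
every `w ⊥ v` (Lagrange–adjugate identity on `k × w ∥ v`: `(kᵀSk)(wᵀSw) = (kᵀSw)² + Q(k×w) ≥ 0`). [folklore] -/
theorem dotProduct_mulVec_nonneg_of_orthogonal (S : Matrix (Fin 3) (Fin 3) ℝ) (hS : S.IsSymm) {v k w : Fin 3 → ℝ} (hv : v ≠ 0)
    (hkv : k ⬝ᵥ v = 0) (hwv : w ⬝ᵥ v = 0) (hadj : 0 ≤ v ⬝ᵥ S.adjugate *ᵥ v) (hT : 0 < k ⬝ᵥ S *ᵥ k) :
    0 ≤ w ⬝ᵥ S *ᵥ w := by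
  have lag := cross_dotProduct_adjugate_mulVec_cross S hS k w
  have hpar := smul_cross_eq_of_orthogonal hkv hwv
  have hvv := dotProduct_self_pos_aux hv
  have hQ : 0 ≤ (v ⬝ᵥ v) ^ 2 * ((k ⨯₃ w) ⬝ᵥ S.adjugate *ᵥ (k ⨯₃ w)) := by
    rw [← dotProduct_mulVec_smul_self, hpar, dotProduct_mulVec_smul_self]
    exact mul_nonneg (sq_nonneg _) hadj
  have hQ' : 0 ≤ (k ⨯₃ w) ⬝ᵥ S.adjugate *ᵥ (k ⨯₃ w) := nonneg_of_mul_nonneg_right hQ (by positivity)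
  -- `(kᵀSk)(wᵀSw) = Q(k×w) + (kᵀSw)² ≥ 0`
  have hprod : 0 ≤ (k ⬝ᵥ S *ᵥ k) * (w ⬝ᵥ S *ᵥ w) := by rw [lag] at hQ'; nlinarith [sq_nonneg (k ⬝ᵥ S *ᵥ w)]
  exact nonneg_of_mul_nonneg_right hprod hT

/-- **The adjugate witness direction is `S`-conjugate to the plane**: `S·(adj(S) v) = det S • v`. [folklore] -/
theorem mulVec_adjugate_mulVec (S : Matrix (Fin 3) (Fin 3) ℝ) (v : Fin 3 → ℝ) : S *ᵥ (S.adjugate *ᵥ v) = S.det • v := by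
  rw [Matrix.mulVec_mulVec, Matrix.mul_adjugate, Matrix.smul_mulVec, Matrix.one_mulVec]

/-- **POSITIVE-SEMIDEFINITENESS FROM AN ADJUGATE WITNESS** (symmetric `3 × 3`, no spectral decomposition): `v ≠ 0` with `vᵀ adj(S) v > 0`,
`k ⊥ v` with `kᵀSk > 0`, and `det S > 0` ⇒ `S ⪰ 0`.  (Split `x` along `z = adj(S) v`, which is `S`-conjugate to `v^⊥` with `zᵀSz = det S · vᵀadj(S)v`,
and a vector of `v^⊥`, where `S ≥ 0` by the previous lemma.) [folklore] -/
theorem posSemidef_of_adjugate_witness (S : Matrix (Fin 3) (Fin 3) ℝ) (hS : S.IsSymm) {v k : Fin 3 → ℝ} (hv : v ≠ 0)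
    (hkv : k ⬝ᵥ v = 0) (hadj : 0 < v ⬝ᵥ S.adjugate *ᵥ v) (hT : 0 < k ⬝ᵥ S *ᵥ k) (hdet : 0 < S.det) : S.PosSemidef := by
  have hSa : S.adjugate.IsSymm := by
    unfold Matrix.IsSymm; rw [Matrix.adjugate_transpose, hS.eq]
  refine Matrix.PosSemidef.of_dotProduct_mulVec_nonneg (isHermitian_iff_isSymm.mpr hS) fun x => ?_
  simp only [star_trivial]
  set z : Fin 3 → ℝ := S.adjugate *ᵥ v with hz
  have hzv : z ⬝ᵥ v = v ⬝ᵥ S.adjugate *ᵥ v := by rw [hz, dotProduct_comm]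
  have hSz : S *ᵥ z = S.det • v := mulVec_adjugate_mulVec S v
  -- the `v^⊥` component `w = (z·v) x − (x·v) z`
  set w : Fin 3 → ℝ := (z ⬝ᵥ v) • x - (x ⬝ᵥ v) • z with hw
  have hwv : w ⬝ᵥ v = 0 := by
    rw [hw, sub_dotProduct, smul_dotProduct, smul_dotProduct, smul_eq_mul, smul_eq_mul]; ring
  have hw0 : 0 ≤ w ⬝ᵥ S *ᵥ w := dotProduct_mulVec_nonneg_of_orthogonal S hS hv hkv hwv hadj.le hT
  -- cross term vanishes and `zᵀSz = det S · (z·v)`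
  have hwz : w ⬝ᵥ S *ᵥ z = 0 := by rw [hSz, dotProduct_smul, hwv, smul_zero]
  have hzz : z ⬝ᵥ S *ᵥ z = S.det * (z ⬝ᵥ v) := by rw [hSz, dotProduct_smul, smul_eq_mul]
  -- expand `(z·v)² xᵀSx`
  have hx : (z ⬝ᵥ v) • x = w + (x ⬝ᵥ v) • z := by rw [hw]; abel
  have key : (z ⬝ᵥ v) ^ 2 * (x ⬝ᵥ S *ᵥ x) = w ⬝ᵥ S *ᵥ w + (x ⬝ᵥ v) ^ 2 * (S.det * (z ⬝ᵥ v)) := by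
    have e1 : (z ⬝ᵥ v) ^ 2 * (x ⬝ᵥ S *ᵥ x) = ((z ⬝ᵥ v) • x) ⬝ᵥ S *ᵥ ((z ⬝ᵥ v) • x) := (dotProduct_mulVec_smul_self S _ x).symm
    rw [e1, hx, Matrix.mulVec_add, Matrix.mulVec_smul, add_dotProduct, dotProduct_add, dotProduct_add, smul_dotProduct, smul_dotProduct,
      dotProduct_smul, dotProduct_smul, hwz, dotProduct_mulVec_comm_of_isSymm hS z w, hwz, hzz]
    simp only [smul_eq_mul]; ring
  have hzv_pos : 0 < z ⬝ᵥ v := by rw [hzv]; exact hadj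
  have hrhs : 0 ≤ (z ⬝ᵥ v) ^ 2 * (x ⬝ᵥ S *ᵥ x) := by
    rw [key]; exact add_nonneg hw0 (mul_nonneg (sq_nonneg _) (mul_pos hdet hzv_pos).le)
  exact nonneg_of_mul_nonneg_right (by rwa [mul_comm] at hrhs) (by positivity)

/-- **POSITIVE-DEFINITENESS FROM AN ADJUGATE WITNESS**: as above, `S ⪰ 0` with `det S ≠ 0` is `S ≻ 0`. [folklore] -/
theorem posDef_of_adjugate_witness (S : Matrix (Fin 3) (Fin 3) ℝ) (hS : S.IsSymm) {v k : Fin 3 → ℝ} (hv : v ≠ 0)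
    (hkv : k ⬝ᵥ v = 0) (hadj : 0 < v ⬝ᵥ S.adjugate *ᵥ v) (hT : 0 < k ⬝ᵥ S *ᵥ k) (hdet : 0 < S.det) : S.PosDef :=
  (posSemidef_of_adjugate_witness S hS hv hkv hadj hT hdet).posDef_iff_det_ne_zero.mpr hdet.ne'

/-! ## 2. HIDDEN DEFINITENESS on the semidefinite cell of the null-top sheet -/

/-- For `3 × 3` matrices `adj(−S) = adj S` (local copy). [folklore] -/
private theorem adjugate_neg_aux (S : Matrix (Fin 3) (Fin 3) ℝ) : (-S).adjugate = S.adjugate := by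
  rw [← neg_one_smul ℝ S, Matrix.adjugate_smul]; simp

/-- **HIDDEN POSITIVE DEFINITENESS.**  `P ⪰ 0` with kernel vector `k` (`P k = 0`), `S` symmetric with `q(S) = tr(adj S · P) > 0`, `det S > 0` and
`kᵀSk > 0` ⇒ `S ≻ 0`.  (Write `P = BᵀB`: `q(S) = ∑ rows rᵀadj(S)r`, so some row `r ⊥ k` is an adjugate witness.)  On the null-top sheet with `S₃ ⪰ 0`: a lower
letter with middle square slot `c_{3xx} > 0`, cube `c_{xxx} > 0` and top slot `c_{33x} > 0` IS POSITIVE DEFINITE — no definite letter was assumed. [folklore] -/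
theorem posDef_of_sheet_signs {P S : Matrix (Fin 3) (Fin 3) ℝ} (hP : P.PosSemidef) {k : Fin 3 → ℝ} (hPk : P *ᵥ k = 0)
    (hS : S.IsSymm) (hq : 0 < (S.adjugate * P).trace) (hdet : 0 < S.det) (hT : 0 < k ⬝ᵥ S *ᵥ k) : S.PosDef := by
  open scoped MatrixOrder in
  obtain ⟨B, hB⟩ := CStarAlgebra.nonneg_iff_eq_star_mul_self.mp hP.nonneg
  have hBT : star B = Bᵀ := by
    rw [star_eq_conjTranspose]; exact Matrix.conjTranspose_eq_transpose_of_trivial B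
  rw [hBT] at hB
  have hBk : B *ᵥ k = 0 := by
    have h0 : k ⬝ᵥ P *ᵥ k = 0 := by rw [hPk, dotProduct_zero]
    rw [hB, ← Matrix.mulVec_mulVec, Matrix.dotProduct_mulVec, Matrix.vecMul_transpose] at h0
    exact dotProduct_self_eq_zero.mp h0
  have hrow : ∀ i, k ⬝ᵥ B i = 0 := fun i => by
    have := congrFun hBk i
    rwa [Matrix.mulVec, Pi.zero_apply, dotProduct_comm] at this
  have htr : (S.adjugate * P).trace = ∑ i, B i ⬝ᵥ S.adjugate *ᵥ B i := by
    rw [hB, ← Matrix.mul_assoc, Matrix.trace_mul_comm, ← Matrix.mul_assoc, Matrix.trace]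
    refine Finset.sum_congr rfl fun i _ => ?_
    rw [Matrix.diag_apply, mul_mul_transpose_apply_diag]
  -- some row is an adjugate witness
  obtain ⟨i, -, hi⟩ : ∃ i ∈ (Finset.univ : Finset (Fin 3)), 0 < B i ⬝ᵥ S.adjugate *ᵥ B i := by
    by_contra hno
    push Not at hno
    have : (S.adjugate * P).trace ≤ 0 := by rw [htr]; exact Finset.sum_nonpos hno
    linarith
  have hvi : B i ≠ 0 := by
    intro h0; rw [h0, zero_dotProduct] at hi; exact lt_irrefl _ hi
  exact posDef_of_adjugate_witness S hS hvi (hrow i) hi hT hdet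

/-- **HIDDEN NEGATIVE DEFINITENESS.**  Same cell (`P ⪰ 0`), `q(S) > 0`, `det S < 0` and `kᵀSk < 0` ⇒ `−S ≻ 0`. [folklore] -/
theorem neg_posDef_of_sheet_signs {P S : Matrix (Fin 3) (Fin 3) ℝ} (hP : P.PosSemidef) {k : Fin 3 → ℝ} (hPk : P *ᵥ k = 0)
    (hS : S.IsSymm) (hq : 0 < (S.adjugate * P).trace) (hdet : S.det < 0) (hT : k ⬝ᵥ S *ᵥ k < 0) : (-S).PosDef := by
  refine posDef_of_sheet_signs hP hPk hS.neg ?_ ?_ ?_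
  · rwa [adjugate_neg_aux]
  · rw [Matrix.det_neg]; simp; linarith
  · rw [Matrix.neg_mulVec, dotProduct_neg]; linarith

/-- **NO DEFINITE LETTER WITH A SPACELIKE SQUARE SLOT.**  `P ⪰ 0`, `q(S) = tr(adj S · P) < 0` ⇒ `S` is neither positive nor negative definite
(`S` definite ⇒ `adj S ≻ 0 ⇒ q(S) ≥ 0`). [folklore] -/
theorem not_definite_of_trace_adjugate_mul_neg {P S : Matrix (Fin 3) (Fin 3) ℝ} (hP : P.PosSemidef) (hq : (S.adjugate * P).trace < 0) :
    ¬ S.PosDef ∧ ¬ (-S).PosDef := by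
  constructor
  · intro hS
    have h := trace_mul_nonneg_of_posSemidef_posDef hP (adjugate_posDef_of_posDef hS)
    rw [Matrix.trace_mul_comm] at h; linarith
  · intro hS
    have h := trace_mul_nonneg_of_posSemidef_posDef hP (adjugate_posDef_of_posDef hS)
    rw [adjugate_neg_aux, Matrix.trace_mul_comm] at h; linarith

/-- **NO DEFINITE LETTER WITH `kᵀSk · det S < 0`.**  For `k ≠ 0`: `S ≻ 0 ⇒ det S > 0 ∧ kᵀSk > 0`, `−S ≻ 0 ⇒ det S < 0 ∧ kᵀSk < 0`. [folklore] -/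
theorem not_definite_of_dotProduct_mulVec_mul_det_neg {S : Matrix (Fin 3) (Fin 3) ℝ} {k : Fin 3 → ℝ} (hk : k ≠ 0)
    (h : (k ⬝ᵥ S *ᵥ k) * S.det < 0) : ¬ S.PosDef ∧ ¬ (-S).PosDef := by
  constructor
  · intro hS
    have h1 : 0 < k ⬝ᵥ S *ᵥ k := by simpa using hS.dotProduct_mulVec_pos hk
    nlinarith [hS.det_pos]
  · intro hS
    have h1 : 0 < k ⬝ᵥ (-S) *ᵥ k := by simpa using hS.dotProduct_mulVec_pos hk
    rw [Matrix.neg_mulVec, dotProduct_neg] at h1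
    have h2 := hS.det_pos
    rw [Matrix.det_neg] at h2; simp at h2
    nlinarith

/-! ## 3. On a hypothetical null-top EIGHTEEN with `S₃ ⪰ 0`: the signs of three slots PIN the type of every lower letter -/

/-- **Top slot versus top-window functional.**  On a null-top eighteen with `S₃ ⪰ 0` and kernel vector `k` of `S₃`: `c_{33x} = tr(adj S₃·S_x)` has the
sign of `kᵀS_xk` (indeed `(k·k)·c_{33x} = tr(adj S₃)·kᵀS_xk` with `tr(adj S₃) > 0`). [folklore] -/
theorem top_slot_mul_dotProduct_mulVec_pos_of_nullTop_eighteen (d : Fin 4 → ℕ) (hd : StrictMono d) (S : Fin 4 → Matrix (Fin 3) (Fin 3) ℝ)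
    (hS : ∀ l, (S l).IsSymm) (h3 : (S 3).det = 0) (hpsd : (S 3).PosSemidef)
    (h18 : 18 ≤ ((Matrix.det (∑ l, ((X : ℝ[X]) ^ d l) • (S l).map C)).roots.toFinset.filter (fun t => 0 < t)).card)
    {k : Fin 3 → ℝ} (hk : k ≠ 0) (hPk : S 3 *ᵥ k = 0) {x : Fin 4} (hx : x ≠ 3) :
    0 < ((S 3).adjugate * S x).trace * (k ⬝ᵥ S x *ᵥ k) := by
  have hne := trace_adjugate_mul_ne_zero_of_nullTop_eighteen d hd S h3 h18 3 x hx.symm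
  have e := dotProduct_self_mul_trace_adjugate_mul (S 3) (S x) (hS 3) hPk
  have hkk : 0 < k ⬝ᵥ k := dotProduct_self_pos_aux hk
  have htr0 : 0 ≤ (S 3).adjugate.trace := (adjugate_posSemidef_of_posSemidef hpsd).trace_nonneg
  have htr : 0 < (S 3).adjugate.trace := by
    refine lt_of_le_of_ne htr0 fun h0 => ?_
    rw [← h0, zero_mul] at e
    exact hne ((mul_eq_zero.mp e).resolve_left hkk.ne')
  have e2 : (S 3).adjugate.trace * (((S 3).adjugate * S x).trace * (k ⬝ᵥ S x *ᵥ k))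
      = (k ⬝ᵥ k) * ((S 3).adjugate * S x).trace ^ 2 := by
    rw [pow_two, ← mul_assoc (k ⬝ᵥ k), e]; ring
  have hsq : 0 < ((S 3).adjugate * S x).trace ^ 2 := by positivity
  have hpos : 0 < (S 3).adjugate.trace * (((S 3).adjugate * S x).trace * (k ⬝ᵥ S x *ᵥ k)) := by
    rw [e2]; exact mul_pos hkk hsq
  exact (pos_iff_pos_of_mul_pos hpos).1 htr

/-- **HIDDEN TYPE OF A LOWER LETTER (semidefinite cell, `S₃ ⪰ 0`).**  On a null-top eighteen (sorted support, symmetric letters, `det S₃ = 0`, `S₃ ⪰ 0`),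
for a lower letter `x ≠ 3` with slots `c_{3xx} = tr(adj S_x·S₃)`, `c_{xxx} = det S_x`, `c_{33x} = tr(adj S₃·S_x)`:
`c_{3xx} > 0 ∧ c_{xxx} > 0 ∧ c_{33x} > 0 ⇒ S_x ≻ 0`; `c_{3xx} > 0 ∧ c_{xxx} < 0 ∧ c_{33x} < 0 ⇒ S_x ≺ 0`; `c_{3xx} < 0`, or `c_{xxx}·c_{33x} < 0`
⇒ `S_x` is neither.  So the three signs PIN the inertia type of every lower letter. [folklore] -/
theorem hiddenType_of_nullTop_eighteen (d : Fin 4 → ℕ) (hd : StrictMono d) (S : Fin 4 → Matrix (Fin 3) (Fin 3) ℝ)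
    (hS : ∀ l, (S l).IsSymm) (h3 : (S 3).det = 0) (hpsd : (S 3).PosSemidef)
    (h18 : 18 ≤ ((Matrix.det (∑ l, ((X : ℝ[X]) ^ d l) • (S l).map C)).roots.toFinset.filter (fun t => 0 < t)).card) {x : Fin 4} (hx : x ≠ 3) :
    (0 < ((S x).adjugate * S 3).trace → 0 < (S x).det → 0 < ((S 3).adjugate * S x).trace → (S x).PosDef)
    ∧ (0 < ((S x).adjugate * S 3).trace → (S x).det < 0 → ((S 3).adjugate * S x).trace < 0 → (-S x).PosDef)
    ∧ (((S x).adjugate * S 3).trace < 0 → ¬ (S x).PosDef ∧ ¬ (-S x).PosDef)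
    ∧ ((S x).det * ((S 3).adjugate * S x).trace < 0 → ¬ (S x).PosDef ∧ ¬ (-S x).PosDef) := by
  obtain ⟨k, hk, hPk⟩ := Matrix.exists_mulVec_eq_zero_iff.mpr h3
  have rel := top_slot_mul_dotProduct_mulVec_pos_of_nullTop_eighteen d hd S hS h3 hpsd h18 hk hPk hx
  refine ⟨fun hq hdet hT => ?_, fun hq hdet hT => ?_, fun hq => not_definite_of_trace_adjugate_mul_neg hpsd hq, fun hprod => ?_⟩
  · exact posDef_of_sheet_signs hpsd hPk (hS x) hq hdet (by nlinarith [rel, hT])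
  · exact neg_posDef_of_sheet_signs hpsd hPk (hS x) hq hdet (by nlinarith [rel, hT])
  · refine not_definite_of_dotProduct_mulVec_mul_det_neg hk ?_
    have e : ((S 3).adjugate * S x).trace * (k ⬝ᵥ S x *ᵥ k) * ((S x).det * ((S 3).adjugate * S x).trace)
        = ((S 3).adjugate * S x).trace ^ 2 * ((k ⬝ᵥ S x *ᵥ k) * (S x).det) := by ring
    have hneg : ((S 3).adjugate * S x).trace * (k ⬝ᵥ S x *ᵥ k) * ((S x).det * ((S 3).adjugate * S x).trace) < 0 :=
      mul_neg_of_pos_of_neg rel hprod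
    rw [e] at hneg
    exact neg_of_mul_neg_right hneg (sq_nonneg _)

/-! ## 4. The two TYPE TESTS (decidable in `d`): a hidden-definite letter against a second lower letter -/

/-- The orientation hypothesis read on the square middle slot: `0 < (−1)^{ρ(2d_x+d₃)}·det S₀ ⇒ c_{3xx} > 0` on a null-top eighteen. [folklore] -/
theorem middle_square_pos_of_orientation (d : Fin 4 → ℕ) (hd : StrictMono d) (S : Fin 4 → Matrix (Fin 3) (Fin 3) ℝ) (h3 : (S 3).det = 0)
    (h18 : 18 ≤ ((Matrix.det (∑ l, ((X : ℝ[X]) ^ d l) • (S l).map C)).roots.toFinset.filter (fun t => 0 < t)).card) {x : Fin 4} (hx : x ≠ 3)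
    (ρ : ℕ → ℕ) (hρ' : ∀ e, ρ e = ((Matrix.det (∑ l, ((X : ℝ[X]) ^ d l) • (S l).map C)).support.filter (· < e)).card)
    (hor : 0 < (-1 : ℝ) ^ ρ (2 * d x + d 3) * (S 0).det) : 0 < ((S x).adjugate * S 3).trace := by
  set P := Matrix.det (∑ l, ((X : ℝ[X]) ^ d l) • (S l).map C) with hP
  obtain ⟨cxx, mxx⟩ := coeff_square_of_nullTop_eighteen d hd S h3 h18 x 3 hx
  obtain ⟨c0, m0⟩ := coeff_cube_of_nullTop_eighteen d hd S h3 h18 0 (by decide)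
  have hrank0 : (P.support.filter (fun c => c < 3 * d 0)).card = 0 := by
    rw [Finset.card_eq_zero, Finset.filter_eq_empty_iff]
    intro c hc
    rw [hP, support_det_pencil_eq_of_nullTop_eighteen d S h3 h18] at hc
    obtain ⟨s, -, rfl⟩ := Finset.mem_image.mp hc
    exact not_lt.mpr (bottom_le_sym_sum_of_strictMono d hd s)
  have r0 := coeff_mul_coeff_sign_of_nullTop_eighteen d S h3 h18 m0 mxx
  rw [c0, cxx, hrank0, zero_add, ← hρ'] at r0
  rcases Nat.mod_two_eq_zero_or_one (ρ (2 * d x + d 3)) with p | p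
  · have := r0.1 p
    rw [neg_one_pow_eq_pow_mod_two, p, pow_zero, one_mul] at hor
    nlinarith [this, hor]
  · have := r0.2 p
    rw [neg_one_pow_eq_pow_mod_two, p, pow_one, neg_one_mul, neg_pos] at hor
    nlinarith [this, hor]

/-- On a null-top eighteen with `S₃ ⪰ 0`: a lower letter `x` with `c_{3xx} > 0` and `ρ(3d_x) ≡ ρ(2d₃+d_x)` is DEFINITE, positive iff `c_{33x} > 0`. [folklore] -/
theorem hiddenDefinite_of_parity (d : Fin 4 → ℕ) (hd : StrictMono d) (S : Fin 4 → Matrix (Fin 3) (Fin 3) ℝ)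
    (hS : ∀ l, (S l).IsSymm) (h3 : (S 3).det = 0) (hpsd : (S 3).PosSemidef) (h18 : 18 ≤ ((Matrix.det (∑ l, ((X : ℝ[X]) ^ d l) • (S l).map C)).roots.toFinset.filter (fun t => 0 < t)).card) {x : Fin 4} (hx : x ≠ 3)
    (ρ : ℕ → ℕ) (hρ' : ∀ e, ρ e = ((Matrix.det (∑ l, ((X : ℝ[X]) ^ d l) • (S l).map C)).support.filter (· < e)).card)
    (hqx : 0 < ((S x).adjugate * S 3).trace) (hxdef : (ρ (3 * d x) + ρ (2 * d 3 + d x)) % 2 = 0) :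
    ((S x).PosDef ∨ (-S x).PosDef) ∧ ((S x).PosDef ↔ 0 < ((S 3).adjugate * S x).trace) := by
  obtain ⟨HP, HN, -, -⟩ := hiddenType_of_nullTop_eighteen d hd S hS h3 hpsd h18 hx
  obtain ⟨cTx, mTx⟩ := coeff_square_of_nullTop_eighteen d hd S h3 h18 3 x hx.symm
  obtain ⟨cx3, mx3⟩ := coeff_cube_of_nullTop_eighteen d hd S h3 h18 x hx
  have rx := (coeff_mul_coeff_sign_of_nullTop_eighteen d S h3 h18 mx3 mTx).1 (by rw [← hρ', ← hρ']; exact hxdef)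
  rw [cx3, cTx] at rx
  have hdx := det_letter_ne_zero_of_nullTop_eighteen d hd S h3 h18 x hx
  obtain ⟨k, hk, hPk⟩ := Matrix.exists_mulVec_eq_zero_iff.mpr h3
  have relx := top_slot_mul_dotProduct_mulVec_pos_of_nullTop_eighteen d hd S hS h3 hpsd h18 hk hPk hx
  rcases lt_or_gt_of_ne hdx with hneg | hpos
  · have hT : ((S 3).adjugate * S x).trace < 0 := by nlinarith [rx, hneg]
    have hN := HN hqx hneg hT
    refine ⟨Or.inr hN, iff_of_false (fun hP' => ?_) (not_lt.mpr hT.le)⟩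
    have h1 : 0 < k ⬝ᵥ S x *ᵥ k := by simpa using hP'.dotProduct_mulVec_pos hk
    nlinarith [relx, h1, hT]
  · have hT : 0 < ((S 3).adjugate * S x).trace := by nlinarith [rx, hpos]
    exact ⟨Or.inl (HP hqx hpos hT), iff_of_true (HP hqx hpos hT) hT⟩

/-- **TYPE TEST DI (`S₃ ⪰ 0`): hidden-definite `x` versus hidden-indefinite `y`.**  Sheet rank `ρ`; orientation `(−1)^{ρ(2d_x+d₃)} det S₀ > 0` (i.e.
`c_{3xx} > 0`); `ρ(3d_x) ≡ ρ(2d₃+d_x)` (`x` hidden-definite); `y` hidden-indefinite (`c_{3yy} < 0`: `ρ(2d_y+d₃) ≢ ρ(2d_x+d₃)`, or `c_{yyy}c_{33y} < 0`: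
`ρ(3d_y)+ρ(2d₃+d_y)` odd); and the edge count `V_xy ∈ {0,3}` — impossible by the propagation law of …SheetDefiniteLetter, so `Z₊ ≤ 17`. [folklore] -/
theorem card_posRoots_le_17_of_semidef_typeTestDI (d : Fin 4 → ℕ) (hd : StrictMono d) (S : Fin 4 → Matrix (Fin 3) (Fin 3) ℝ)
    (hS : ∀ l, (S l).IsSymm) (h3 : (S 3).det = 0) (hpsd : (S 3).PosSemidef)
    (ρ : ℕ → ℕ) (hρ : ∀ e, ρ e = ((((Finset.univ : Finset (Sym (Fin 4) 3)).erase (Sym.replicate 3 3)).image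
          (fun s : Sym (Fin 4) 3 => ((s : Multiset (Fin 4)).map d).sum)).filter (· < e)).card)
    {x y : Fin 4} (hxy : x ≠ y) (hx : x ≠ 3) (hy : y ≠ 3)
    (hor : 0 < (-1 : ℝ) ^ ρ (2 * d x + d 3) * (S 0).det)
    (hxdef : (ρ (3 * d x) + ρ (2 * d 3 + d x)) % 2 = 0)
    (hyind : ρ (2 * d y + d 3) % 2 ≠ ρ (2 * d x + d 3) % 2 ∨ (ρ (3 * d y) + ρ (2 * d 3 + d y)) % 2 = 1)
    (hV : (ρ (3 * d x) + ρ (2 * d x + d y)) % 2 + (ρ (2 * d x + d y) + ρ (2 * d y + d x)) % 2 + (ρ (2 * d y + d x) + ρ (3 * d y)) % 2 = 0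
      ∨ (ρ (3 * d x) + ρ (2 * d x + d y)) % 2 + (ρ (2 * d x + d y) + ρ (2 * d y + d x)) % 2 + (ρ (2 * d y + d x) + ρ (3 * d y)) % 2 = 3) :
    ((Matrix.det (∑ l, ((X : ℝ[X]) ^ d l) • (S l).map C)).roots.toFinset.filter (fun t => 0 < t)).card ≤ 17 := by
  by_contra hlt
  have h18 : 18 ≤ ((Matrix.det (∑ l, ((X : ℝ[X]) ^ d l) • (S l).map C)).roots.toFinset.filter (fun t => 0 < t)).card := by omega
  have hρ' : ∀ e, ρ e = ((Matrix.det (∑ l, ((X : ℝ[X]) ^ d l) • (S l).map C)).support.filter (· < e)).card := fun e => by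
    rw [hρ, sheetRank_eq_of_nullTop_eighteen d S h3 h18]
  have hqx := middle_square_pos_of_orientation d hd S h3 h18 hx ρ hρ' hor
  obtain ⟨hxd, -⟩ := hiddenDefinite_of_parity d hd S hS h3 hpsd h18 hx ρ hρ' hqx hxdef
  obtain ⟨-, -, HI1y, HI2y⟩ := hiddenType_of_nullTop_eighteen d hd S hS h3 hpsd h18 hy
  obtain ⟨cxx, mxx⟩ := coeff_square_of_nullTop_eighteen d hd S h3 h18 x 3 hx
  obtain ⟨cyy, myy⟩ := coeff_square_of_nullTop_eighteen d hd S h3 h18 y 3 hy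
  obtain ⟨cTy, mTy⟩ := coeff_square_of_nullTop_eighteen d hd S h3 h18 3 y hy.symm
  obtain ⟨cy3, my3⟩ := coeff_cube_of_nullTop_eighteen d hd S h3 h18 y hy
  have hyn : ¬ (S y).PosDef ∧ ¬ (-S y).PosDef := by
    rcases hyind with hpar | hpar
    · have rxy := (coeff_mul_coeff_sign_of_nullTop_eighteen d S h3 h18 mxx myy).2 (by rw [← hρ', ← hρ']; omega)
      rw [cxx, cyy] at rxy
      exact HI1y (by nlinarith [rxy, hqx])
    · have ry := (coeff_mul_coeff_sign_of_nullTop_eighteen d S h3 h18 my3 mTy).2 (by rw [← hρ', ← hρ']; exact hpar)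
      rw [cy3, cTy] at ry
      exact HI2y ry
  obtain ⟨v1, v2⟩ := definite_indefinite_count_sheet d hd S hS h3 hxy hx hy hxd hyn.1 hyn.2 h18 ρ hρ'
  rcases hV with hV | hV
  · exact v1 hV
  · exact v2 hV

/-- **TYPE TEST DD (`S₃ ⪰ 0`): two hidden-definite lower letters.**  Orientation `c_{3xx} > 0`; `x` and `y` both hidden-definite (`c_{3yy} > 0` too); the pair
law of …SheetDefiniteLetter demands `V_xy = 0` when `c_{33x}c_{33y} > 0` (same sign) and `V_xy = 3` otherwise — if the chamber says otherwise, `Z₊ ≤ 17`. [folklore] -/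
theorem card_posRoots_le_17_of_semidef_typeTestDD (d : Fin 4 → ℕ) (hd : StrictMono d) (S : Fin 4 → Matrix (Fin 3) (Fin 3) ℝ)
    (hS : ∀ l, (S l).IsSymm) (h3 : (S 3).det = 0) (hpsd : (S 3).PosSemidef)
    (ρ : ℕ → ℕ) (hρ : ∀ e, ρ e = ((((Finset.univ : Finset (Sym (Fin 4) 3)).erase (Sym.replicate 3 3)).image
          (fun s : Sym (Fin 4) 3 => ((s : Multiset (Fin 4)).map d).sum)).filter (· < e)).card)
    {x y : Fin 4} (hxy : x ≠ y) (hx : x ≠ 3) (hy : y ≠ 3)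
    (hor : 0 < (-1 : ℝ) ^ ρ (2 * d x + d 3) * (S 0).det)
    (hxdef : (ρ (3 * d x) + ρ (2 * d 3 + d x)) % 2 = 0)
    (hysq : ρ (2 * d y + d 3) % 2 = ρ (2 * d x + d 3) % 2) (hydef : (ρ (3 * d y) + ρ (2 * d 3 + d y)) % 2 = 0)
    (hV : ((ρ (2 * d 3 + d x) + ρ (2 * d 3 + d y)) % 2 = 0 ∧
        (ρ (3 * d x) + ρ (2 * d x + d y)) % 2 + (ρ (2 * d x + d y) + ρ (2 * d y + d x)) % 2 + (ρ (2 * d y + d x) + ρ (3 * d y)) % 2 ≠ 0)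
      ∨ ((ρ (2 * d 3 + d x) + ρ (2 * d 3 + d y)) % 2 = 1 ∧
        (ρ (3 * d x) + ρ (2 * d x + d y)) % 2 + (ρ (2 * d x + d y) + ρ (2 * d y + d x)) % 2 + (ρ (2 * d y + d x) + ρ (3 * d y)) % 2 ≠ 3)) :
    ((Matrix.det (∑ l, ((X : ℝ[X]) ^ d l) • (S l).map C)).roots.toFinset.filter (fun t => 0 < t)).card ≤ 17 := by
  by_contra hlt
  have h18 : 18 ≤ ((Matrix.det (∑ l, ((X : ℝ[X]) ^ d l) • (S l).map C)).roots.toFinset.filter (fun t => 0 < t)).card := by omega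
  have hρ' : ∀ e, ρ e = ((Matrix.det (∑ l, ((X : ℝ[X]) ^ d l) • (S l).map C)).support.filter (· < e)).card := fun e => by
    rw [hρ, sheetRank_eq_of_nullTop_eighteen d S h3 h18]
  have hqx := middle_square_pos_of_orientation d hd S h3 h18 hx ρ hρ' hor
  obtain ⟨cxx, mxx⟩ := coeff_square_of_nullTop_eighteen d hd S h3 h18 x 3 hx
  obtain ⟨cyy, myy⟩ := coeff_square_of_nullTop_eighteen d hd S h3 h18 y 3 hy
  obtain ⟨cTx, mTx⟩ := coeff_square_of_nullTop_eighteen d hd S h3 h18 3 x hx.symm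
  obtain ⟨cTy, mTy⟩ := coeff_square_of_nullTop_eighteen d hd S h3 h18 3 y hy.symm
  have rxy := (coeff_mul_coeff_sign_of_nullTop_eighteen d S h3 h18 mxx myy).1 (by rw [← hρ', ← hρ']; omega)
  rw [cxx, cyy] at rxy
  have hqy : 0 < ((S y).adjugate * S 3).trace := by nlinarith [rxy, hqx]
  obtain ⟨hxd, hxiff⟩ := hiddenDefinite_of_parity d hd S hS h3 hpsd h18 hx ρ hρ' hqx hxdef
  obtain ⟨hyd, hyiff⟩ := hiddenDefinite_of_parity d hd S hS h3 hpsd h18 hy ρ hρ' hqy hydef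
  obtain ⟨w0, w3⟩ := definite_pair_count_sheet d hd S h3 hxy hx hy hxd hyd h18 ρ hρ'
  have rT := coeff_mul_coeff_sign_of_nullTop_eighteen d S h3 h18 mTx mTy
  rw [cTx, cTy, ← hρ', ← hρ'] at rT
  have hTx := trace_adjugate_mul_ne_zero_of_nullTop_eighteen d hd S h3 h18 3 x hx.symm
  rcases hV with ⟨hpar, hV⟩ | ⟨hpar, hV⟩
  · have hTT := rT.1 hpar
    refine hV (w0 ?_)
    rw [hxiff, hyiff]
    rcases lt_or_gt_of_ne hTx with hn | hp
    · exact iff_of_false (not_lt.mpr hn.le) (fun h => by nlinarith [hTT, hn, h])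
    · exact iff_of_true hp (by nlinarith [hTT, hp])
  · have hTT := rT.2 hpar
    refine hV (w3 fun hiff => ?_)
    rw [hxiff, hyiff] at hiff
    rcases lt_or_gt_of_ne hTx with hn | hp
    · have hy' : ¬ 0 < ((S 3).adjugate * S y).trace := fun h => absurd (hiff.mpr h) (not_lt.mpr hn.le)
      nlinarith [hTT, hn, not_lt.mp hy']
    · nlinarith [hTT, hp, hiff.mp hp]

end Summit.ValiantsHypothesis.ValiantsHypothesis.Theorems.LacunarySymmetroidMatrixDescartes.Census
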